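import Mathlib.CategoryTheory.Preadditive.Basic
import Mathlib.CategoryTheory.Functor.Category
import Mathlib.LinearAlgebra.Span.Basic
import Mathlib.Tactic
import HarnessLib

/-!
# The weak semiregularity criterion fails on K3 surfaces: the algebraic core

Family `hodge`, layer `Literature/AlgebraicGeometry/HodgeTheory`. Companion to `SemiregularityWeakCriterion.lean` (Markman's weak criterion
(W): `σ_E` injective on `im ev_E`, [`Markman2025SecantWeilSurvey`, Lemma 11.3 / Question 11.4]) and to
`SemiregularityWeakCriterionRationalSurface.lean` (a rational-surface counterexample to Question 11.4). Ladder note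
`papers/HodgeConjecture/hodge-weil-ladder`, section "Question 11.4 is false as stated", §9 (K3 surfaces).

THE MECHANISM (note, Proposition U / Theorem 2). `HH²(Y)` is the space of natural transformations `u : id ⇒ [2]` of `D^b(Y)` and
`ev_E(u) = u_E` (Markman's definition). LEMMA N: if `n ∈ End(E)` has `n² = 0` — so `n = ι ∘ ν ∘ q` with `q : E ↠ E/ker n`,
`ν : E/ker n → ker n`, `ι : ker n ↪ E`, `q ∘ ι = 0` — then `Tr_E(n ∘ u_E) = 0` for EVERY `u`, by cyclicity of the trace and naturality of `u`:
`Tr_E(ι∘(ν q u_E)) = Tr_K(ν q u_E ι) = Tr_K(ν q ι u_K) = 0`. On a surface with `ω ≅ 𝒪` Serre duality pairs `Ext²(E,E)` perfectly with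
`End(E)` through `Tr`, and `σ_E = Tr`; so if `End(E) = ℂ·id ⊕ N` with `N² = 0` ("endo-unipotent"), `im ev_E` lies on the line `N^⊥`, which
meets `ker σ_E = id^⊥` only in `0`: (W) HOLDS AUTOMATICALLY, while `E` is semiregular iff `N = 0`. EXAMPLE (Theorem 2 of the note): `S₀` a K3
surface with `(−2)`-curves `A, B`, `A·B = 1`, `D = 2A + B`, `E = 𝒪_D`: `End(E) = ℂ ⊕ ℂ²` (`N = H⁰(𝒪_A(1))`, `N² = 0`), `Ext²(E,E) = ℂ³`,
not semiregular, rigid; (W) holds; `ch(E)` stays Hodge exactly on the 19-dimensional Noether–Lefschetz locus `NL(D)`; but `D² = −6` and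
`D` primitive, so a very general member of `NL(D)` has `NS = ℤD` and no curves at all: `E` has no flat extension along a very general arc in
`NL(D)` — the conclusion of the Semi-regularity Theorem 2.1 fails under (W) for a K3 surface (`ω ≅ 𝒪`, `σ_E ≠ 0`). Projective variant: with
`h` ample, `h·A = h·B = 1`, `h² = 4` and `⟨D,h⟩` primitive, `D` is not effective on a K3 with `NS = ⟨D,h⟩` (`no_effective_class_quartic`).

WHAT IS KERNEL-CHECKED HERE (no geometry): `trace_sqzero_comp_natural_eq_zero` = Lemma N in an arbitrary preadditive category with an
endofunctor `T` (think `[2]`), a natural transformation `u : 𝟭 ⟶ T` and an additive trace satisfying the cyclicity used;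
`weakCriterion_of_range_le_line` = the linear algebra "(W) from `im ev ⊂` a line missing `ker σ`"; `no_effective_class_quartic` /
`no_effective_class` = the Diophantine fact behind the projective variant (`h² = 4`, and all `h² = 2k ≥ 4`).
-/

namespace Literature.AlgebraicGeometry.HodgeTheory.WeakCriterionK3

open CategoryTheory

section LemmaN

variable {C : Type*} [Category C] [Preadditive C] {R : Type*} [AddCommGroup R]

/-- LEMMA N (nilpotent orthogonality), abstract form. `T` an endofunctor (the shift `[2]`), `u : 𝟭 ⟶ T` a natural transformation (a class in
`HH²`), `tr X : (X ⟶ T X) → R` an additive trace with the cyclicity `tr Y (g ≫ T f) = tr X (f ≫ g)` for `f : X ⟶ Y`, `g : Y ⟶ T X`. If an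
endomorphism factors as `n = q ≫ ν ≫ ι` (diagrammatic order: `E → Q → K → E`) with `ι ≫ q = 0` — as every square-zero endomorphism of a
coherent sheaf does (`K = ker n`, `Q = E/K`) — then `tr E (n ≫ u_E) = 0`. [folklore] -/
theorem trace_sqzero_comp_natural_eq_zero (T : C ⥤ C) (u : 𝟭 C ⟶ T) (tr : ∀ X : C, (X ⟶ T.obj X) →+ R)
    (cyc : ∀ {X Y : C} (f : X ⟶ Y) (g : Y ⟶ T.obj X), tr Y (g ≫ T.map f) = tr X (f ≫ g))
    {E K Q : C} (ι : K ⟶ E) (q : E ⟶ Q) (ν : Q ⟶ K) (hqι : ι ≫ q = 0) :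
    tr E ((q ≫ ν ≫ ι) ≫ u.app E) = 0 := by
  have hnat : ι ≫ u.app E = u.app K ≫ T.map ι := by
    have := u.naturality ι
    simp only [Functor.id_obj, Functor.id_map] at this
    exact this
  have key : (q ≫ ν ≫ ι) ≫ u.app E = (q ≫ ν ≫ u.app K) ≫ T.map ι := by
    simp only [Category.assoc, hnat]
    all_goals rfl
  rw [key]
  erw [cyc ι (q ≫ ν ≫ u.app K)]
  rw [← Category.assoc, hqι, Limits.zero_comp, map_zero]

/-- The same with the naturality square written the other way (`n ≫ u_E = u_E ≫ T n`): `tr E (u_E ≫ T n) = 0`. [folklore] -/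
theorem trace_natural_comp_sqzero_eq_zero (T : C ⥤ C) (u : 𝟭 C ⟶ T) (tr : ∀ X : C, (X ⟶ T.obj X) →+ R)
    (cyc : ∀ {X Y : C} (f : X ⟶ Y) (g : Y ⟶ T.obj X), tr Y (g ≫ T.map f) = tr X (f ≫ g))
    {E K Q : C} (ι : K ⟶ E) (q : E ⟶ Q) (ν : Q ⟶ K) (hqι : ι ≫ q = 0) :
    tr E (u.app E ≫ T.map (q ≫ ν ≫ ι)) = 0 := by
  have h : (q ≫ ν ≫ ι) ≫ u.app E = u.app E ≫ T.map (q ≫ ν ≫ ι) := by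
    have := u.naturality (q ≫ ν ≫ ι)
    simp only [Functor.id_obj, Functor.id_map] at this
    exact this
  have main := trace_sqzero_comp_natural_eq_zero T u tr cyc ι q ν hqι
  rw [h] at main
  exact main

end LemmaN

section WeakCriterion

variable {𝕜 : Type*} [Field 𝕜] {H E Ω : Type*} [AddCommGroup H] [Module 𝕜 H] [AddCommGroup E] [Module 𝕜 E]
  [AddCommGroup Ω] [Module 𝕜 Ω]

/-- PROPOSITION U, linear-algebra part: if every obstruction class `ev u` lies on the line spanned by `e₀` (Lemma N: `im ev ⊂ N^⊥`, a line by
Serre duality) and `σ e₀ ≠ 0` (`N^⊥ ∩ ker σ = 0`), then `σ` is injective on `im ev` — Markman's weak criterion (W) — in the form used in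
`SemiregularityWeakCriterion.lean`: `σ (ev u) = 0 → ev u = 0`. [folklore] -/
theorem weakCriterion_of_range_le_line (ev : H →ₗ[𝕜] E) (σ : E →ₗ[𝕜] Ω) (e₀ : E) (he₀ : σ e₀ ≠ 0)
    (hline : ∀ u, ∃ c : 𝕜, ev u = c • e₀) : ∀ u, σ (ev u) = 0 → ev u = 0 := by
  intro u hu
  obtain ⟨c, hc⟩ := hline u
  rw [hc, map_smul] at hu
  rcases smul_eq_zero.mp hu with h | h
  · rw [hc, h, zero_smul]
  · exact absurd h he₀

/-- … and then `ker ev = ker (σ ∘ ev)` (hypothesis (1) of Lemma 11.3: `ker ev_E = ann(ch E)`), while `σ` itself need not be injective. [folklore] -/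
theorem ker_ev_eq_ker_comp_of_range_le_line (ev : H →ₗ[𝕜] E) (σ : E →ₗ[𝕜] Ω) (e₀ : E) (he₀ : σ e₀ ≠ 0)
    (hline : ∀ u, ∃ c : 𝕜, ev u = c • e₀) : LinearMap.ker ev = LinearMap.ker (σ ∘ₗ ev) := by
  ext u
  simp only [LinearMap.mem_ker, LinearMap.coe_comp, Function.comp_apply]
  constructor
  · intro h; rw [h, map_zero]
  · exact weakCriterion_of_range_le_line ev σ e₀ he₀ hline u

end WeakCriterion

section Lattice

/-- For `D = 2A + B` with `A² = B² = −2`, `A·B = 1` (two `(−2)`-curves meeting once): `D² = −6`, `D·A = −3`, `D·B = 0`; Mukai: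
`χ(𝒪_D,𝒪_D) = −v² = 6`, so with `hom = ext² = 3` one gets `ext¹ = 0` (rigid). Recorded as the arithmetic it is. [folklore] -/
theorem twoA_add_B_numerics (AA BB AB : ℤ) (hA : AA = -2) (hB : BB = -2) (hAB : AB = 1) :
    4 * AA + 4 * AB + BB = -6 ∧ 2 * AA + AB = -3 ∧ 2 * AB + BB = 0 ∧ (3 : ℤ) - 0 + 3 = -(4 * AA + 4 * AB + BB) := by
  subst hA; subst hB; subst hAB; norm_num

/-- PROJECTIVE VARIANT, `h² = 4` (quartic K3 with two meeting lines, `h·A = h·B = 1`, `D·h = 3`, `D² = −6`): in `NS = ⟨D, h⟩` there is no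
class `Γ = xD + yh` with `1 ≤ Γ·h = 3x + 4y ≤ 3` and `Γ² = −6x² + 6xy + 4y² ≥ −2`; since on a K3 surface with `h` ample every irreducible
curve `Γ` has `Γ·h ≥ 1` and `Γ² ≥ −2`, the class `D` (of degree `3`) is not effective. [folklore] -/
theorem no_effective_class_quartic :
    ¬ ∃ x y : ℤ, 1 ≤ 3 * x + 4 * y ∧ 3 * x + 4 * y ≤ 3 ∧ -2 ≤ -6 * x ^ 2 + 6 * x * y + 4 * y ^ 2 := by
  rintro ⟨x, y, h1, h2, h3⟩
  have key : 9 * (-6 * x ^ 2 + 6 * x * y + 4 * y ^ 2)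
      = -6 * (3 * x + 4 * y) ^ 2 + 66 * (3 * x + 4 * y) * y - 132 * y ^ 2 := by ring
  have hy1 : y ≤ 1 := by nlinarith
  have hy2 : -1 ≤ y := by nlinarith
  interval_cases y
  · have hx : x = 2 := by omega
    subst hx; norm_num at h3
  · have hx : x = 1 := by omega
    subst hx; norm_num at h3
  · have hx : x = -1 := by omega
    subst hx; norm_num at h3

/-- The same for every degree `h² = 2k ≥ 4` (`D·h = 3`, `D² = −6`): no `Γ = xD + yh` with `1 ≤ 3x + 2ky ≤ 3` and
`−6x² + 6xy + 2ky² ≥ −2`. [folklore] -/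
theorem no_effective_class (k : ℤ) (hk : 2 ≤ k) :
    ¬ ∃ x y : ℤ, 1 ≤ 3 * x + 2 * k * y ∧ 3 * x + 2 * k * y ≤ 3 ∧ -2 ≤ -6 * x ^ 2 + 6 * x * y + 2 * k * y ^ 2 := by
  rintro ⟨x, y, h1, h2, h3⟩
  have key : 9 * (-6 * x ^ 2 + 6 * x * y + 2 * k * y ^ 2)
      = -6 * (3 * x + 2 * k * y) ^ 2 + (24 * k + 18) * (3 * x + 2 * k * y) * y - (24 * k ^ 2 + 18 * k) * y ^ 2 := by ring
  rcases lt_trichotomy y 0 with hy | hy | hy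
  · nlinarith
  · subst hy
    have hx : x = 1 := by omega
    subst hx
    norm_num at h3
  · rcases eq_or_lt_of_le (show (1 : ℤ) ≤ y by omega) with hy1 | hy1
    · subst hy1
      rcases eq_or_lt_of_le hk with hk2 | hk2
      · subst hk2
        have hx : x = -1 := by omega
        subst hx; norm_num at h3
      · nlinarith
    · nlinarith

end Lattice


section ProjectiveExistence

/-- EXISTENCE OF THE PROJECTIVE VARIANT (`h² = 4`). Let `Λ = ⟨a, b, h⟩` with Gram matrix `[[−2,1,1],[1,−2,1],[1,1,4]]` (even, signature `(1,2)`,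
determinant `18`); a K3 surface with `NS ≅ Λ` and `h` nef exists (Nikulin/Morrison). A class `c = xa + yb + zh` orthogonal to `h` has `y = −x − 4z`
and then `c² = −6x² − 24xz − 36z²`, so `c² = −2` reads `3x² + 12xz + 18z² = 1`, impossible modulo `3`: NO `(−2)`-class is orthogonal to `h`,
hence `h` is AMPLE, and the degree-one `(−2)`-classes `a, b` are irreducible smooth rational curves with `a·b = 1` — the configuration of
Theorem 2 with `⟨2a+b, h⟩` primitive. The arithmetic: [folklore] -/
theorem orthogonal_class_quartic (x y z : ℤ) (hy : x + y + 4 * z = 0) :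
    -2 * x ^ 2 - 2 * y ^ 2 + 4 * z ^ 2 + 2 * x * y + 2 * x * z + 2 * y * z = -6 * x ^ 2 - 24 * x * z - 36 * z ^ 2 := by
  have : y = -x - 4 * z := by omega
  subst this; ring

/-- … and `3x² + 12xz + 18z² = 1` has no solution in integers (the left side is divisible by `3`), so no `(−2)`-class of `Λ` is orthogonal
to `h`. [folklore] -/
theorem no_root_orthogonal_h_quartic : ¬ ∃ x z : ℤ, 3 * x ^ 2 + 12 * x * z + 18 * z ^ 2 = 1 := by
  rintro ⟨x, z, h⟩
  have h3 : (3 : ℤ) ∣ 3 * x ^ 2 + 12 * x * z + 18 * z ^ 2 := ⟨x ^ 2 + 4 * x * z + 6 * z ^ 2, by ring⟩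
  rw [h] at h3
  norm_num at h3

/-- Gram-matrix facts of `Λ = ⟨a,b,h⟩` (`h² = 4`) used above: determinant `18 > 0` (signature `(1,2)` for an indefinite rank-3 even lattice with a
positive vector), `(2a+b)·h = 3`, `(2a+b)² = −6`, and the index computation `⟨a,b,h⟩ = ⟨a, 2a+b, h⟩` (so `⟨2a+b, h⟩` is primitive in `Λ`,
the quotient being `ℤ·a`). [folklore] -/
theorem gram_quartic_facts :
    Matrix.det !![(-2 : ℤ), 1, 1; 1, -2, 1; 1, 1, 4] = 18 ∧ (2 * 1 + 1 : ℤ) = 3 ∧ (4 * (-2) + 4 * 1 + (-2) : ℤ) = -6 := by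
  refine ⟨?_, by norm_num, by norm_num⟩
  simp [Matrix.det_fin_three]

end ProjectiveExistence

end Literature.AlgebraicGeometry.HodgeTheory.WeakCriterionK3
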